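import Summits.KontsevichZagierPeriods.KontsevichZagierPeriods.Theorems.OctahedralSymmetryOctahedralInvolutionMove
import Literature.NumberTheory.Transcendental.CyclotomicSimplexRep
import Literature.NumberTheory.Transcendental.KZGroundingRelations
import Literature.NumberTheory.Transcendental.KZSubcalculusInvariants
import Literature.NumberTheory.Transcendental.KZLogCalculusProofs

/-!
# `ZhaoRelationInKZ` (stmt-KontsevichZagierPeriods-9433), line `Sketch`: the σ-engine at weight 3

Stub `stub_sigma` of the line.  For a convergent level-4 word `W = (m₀, m₁, m₂)` (letters
`Fin 5`: `m ≤ 3` is the pole `i^m`, `4` is the pole `0`; outer → inner; `m₀ ≠ 0`, `m₂ ≠ 4`) the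
element `[W] + Σ_{(c, V) ∈ expand σ W} c · [reverse V]` of `KZ.FormalRep` (real parts, and
imaginary parts, of the rational simplex representations `KZ.levelFourRepRe/Im`) lies in
`KZ.relations`: ONE change of variables `Φ(t)ⱼ = σ(t_{2-j})`, `σ(u) = (1 - u)/(1 + u)`, on `Δ₃`
(`OctahedralInvolutionMove_of`, Jacobian `∏ⱼ 2/(1 + tⱼ)²`; the pull-back exists by the
change-of-variables formula, `sigma_pullback_exists`), then Zhao's letterwise partial fractions
`(σ(u) - pole a)⁻¹ · 2/(1+u)² = -Σ_{(c,b) ∈ σ(a)} c (u - pole b)⁻¹` (`sigma_letter`), their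
trilinear expansion (`sigma_pointwiseC`) and iterated integrand additivity with integer
coefficients (rule (1b)).  Real and imaginary parts at once: the argument runs for any
`ℝ`-linear `π : ℂ →ₗ[ℝ] ℝ` (`sigma_core`).  References: J. Zhao, *Multiple polylogarithm values at
roots of unity*, C. R. Acad. Sci. Paris 346 (2008), arXiv:0810.1064, §4; M. Kontsevich, D. Zagier,
*Periods* (2001), §1.2, rules (1), (2).
-/

noncomputable section

open Set MeasureTheory Complex
open Literature.NumberTheory.Transcendental Literature.NumberTheory.Transcendental.KZ
open Summit.KontsevichZagierPeriods.OctahedralSymmetry.OctahedralInvolutionMove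

namespace Summit.KontsevichZagierPeriods.OctahedralSymmetry.ZhaoRelationInKZ

/-! ## Combinatorics of Zhao's letter table -/

/-- In Zhao's table `σ^*ω_a = ω_{σ a} - ω_{-1}` the pole `0` (letter `4`) only arises from the
pole `1` (letter `0`). [cite: Zhao2008, §4] -/
theorem sigma_table_ne_four : ∀ m : Fin 5, m ≠ 0 → ∀ cb ∈ LevelFour.sigmaLetter m, cb.2 ≠ 4 := by
  decide

/-- In Zhao's table the pole `1` (letter `0`) only arises from the pole `0` (letter `4`).
[cite: Zhao2008, §4] -/
theorem sigma_table_ne_zero : ∀ m : Fin 5, m ≠ 4 → ∀ cb ∈ LevelFour.sigmaLetter m, cb.2 ≠ 0 := by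
  decide

/-- A three-letter word is convergent iff its first letter is not the pole `1` and its last
letter is not the pole `0`. [cite: Zhao2010, §2] -/
theorem sigma_isConvergent_triple {a b c : Fin 5} (ha : a ≠ 0) (hc : c ≠ 4) :
    LevelFour.IsConvergent [a, b, c] :=
  ⟨fun h => ha (Option.some.inj h), fun h => hc (Option.some.inj h)⟩

/-- The complex integrand of a three-letter word is the product of its three letters.
[cite: Zhao2010, §1 eq. (2)] -/
theorem sigma_integrandC_triple (a b c : Fin 5) (t : Fin 3 → ℝ) :
    levelFourIntegrandC [a, b, c] t =
      levelFourFactor a (t 0) * levelFourFactor b (t 1) * levelFourFactor c (t 2) := by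
  show ∏ j : Fin 3, levelFourFactor ([a, b, c].get j) (t j) = _
  rw [Fin.prod_univ_three]
  rfl

/-! ## List and finite-sum algebra -/

/-- `Σ` over a `flatMap` is the iterated sum. [folklore] -/
theorem sigma_sum_flatMap {α M : Type*} [AddCommMonoid M] (l : List α) (f : α → List M) :
    (l.flatMap f).sum = (l.map fun a => (f a).sum).sum := by
  induction l with
  | nil => rfl
  | cons a l ih => simp [List.flatMap_cons, List.sum_append, ih]

/-- A list sum is a finite sum over positions. [folklore] -/
theorem sigma_sum_map_eq {α M : Type*} [AddCommMonoid M] (l : List α) (f : α → M) :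
    (l.map f).sum = ∑ i : Fin l.length, f (l.get i) := by
  simp

/-- **`expand` over a three-letter word** is the finite sum over the positions in the three letter
tables, the coefficient being the product of the three coefficients and the word the three
substituted letters. [folklore] -/
theorem sigma_expand_triple {M : Type*} [AddCommMonoid M] (φ : Fin 5 → List (ℤ × Fin 5))
    (m₀ m₁ m₂ : Fin 5) (F : ℤ × List (Fin 5) → M) :
    ((LevelFour.expand φ [m₀, m₁, m₂]).map F).sum =
      ∑ p : Fin (φ m₀).length × Fin (φ m₁).length × Fin (φ m₂).length,
        F (((φ m₀).get p.1).1 * (((φ m₁).get p.2.1).1 * (((φ m₂).get p.2.2).1 * 1)),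
          [((φ m₀).get p.1).2, ((φ m₁).get p.2.1).2, ((φ m₂).get p.2.2).2]) := by
  simp only [LevelFour.expand_cons, LevelFour.expand_nil, List.map_cons, List.map_nil,
    List.map_flatMap, sigma_sum_flatMap, List.sum_cons, List.sum_nil, add_zero, sigma_sum_map_eq]
  simp only [Fintype.sum_prod_type]

/-- The product of three finite sums is the sum over the product of the index types. [folklore] -/
theorem sigma_prod_three_sums {α β γ : Type*} [Fintype α] [Fintype β] [Fintype γ]
    (A : α → ℂ) (B : β → ℂ) (C : γ → ℂ) :
    (∑ i, A i) * (∑ j, B j) * (∑ k, C k) = ∑ p : α × β × γ, A p.1 * B p.2.1 * C p.2.2 := by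
  rw [Fintype.sum_prod_type]
  simp only [Fintype.sum_prod_type]
  rw [Finset.sum_mul_sum, Finset.sum_mul]
  refine Finset.sum_congr rfl fun i _ => ?_
  rw [Finset.sum_mul_sum]

/-! ## Zhao's partial fractions for one letter -/

/-- **The Cayley identity behind `σ^*ω_p = ω_{σ p} - ω_{-1}`**: for a pole `p = σ(q) = (1-q)/(1+q)`
(`q ≠ -1`), `(σ(v) - p)⁻¹ · 2/(1+v)² = -(v - q)⁻¹ + (v + 1)⁻¹` wherever all terms are defined
(`σ(v) - p = -2(v - q)/((1+v)(1+q))`). [cite: Zhao2008, §4] -/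
theorem sigma_cayley {p q v : ℂ} (hq : 1 + q ≠ 0) (hpq : p = (1 - q) / (1 + q)) (hv : 1 + v ≠ 0)
    (hvq : v - q ≠ 0) :
    ((1 - v) / (1 + v) - p)⁻¹ * (2 / (1 + v) ^ 2) = -(v - q)⁻¹ + (v + 1)⁻¹ := by
  subst hpq
  have hv' : v + 1 ≠ 0 := by rwa [add_comm]
  have h2 : -(2 * (v - q)) ≠ 0 := neg_ne_zero.mpr (mul_ne_zero two_ne_zero hvq)
  have key : (1 - v) / (1 + v) - (1 - q) / (1 + q) = -(2 * (v - q)) / ((1 + v) * (1 + q)) := by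
    field_simp [hq, hv]
    ring
  rw [key, inv_div]
  field_simp [hq, hv, hv', hvq, h2]
  ring

/-- **`σ^*ω_{-1} = -ω_{-1}`**: `(σ(v) + 1)⁻¹ · 2/(1+v)² = (v + 1)⁻¹` (`σ(v) + 1 = 2/(1+v)`).
[cite: Zhao2008, §4] -/
theorem sigma_cayley_neg_one {v : ℂ} (hv : 1 + v ≠ 0) :
    ((1 - v) / (1 + v) - -1)⁻¹ * (2 / (1 + v) ^ 2) = (v + 1)⁻¹ := by
  have hv' : v + 1 ≠ 0 := by rwa [add_comm]
  have key : (1 - v) / (1 + v) - -1 = 2 / (1 + v) := by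
    field_simp [hv]
    ring
  rw [key, inv_div]
  field_simp [hv, hv']
  ring

/-- **Zhao's letterwise partial fractions** (`σ^*ω_a = ω_{σ a} - ω_{-1}` for `a ≠ -1`,
`σ^*ω_{-1} = -ω_{-1}`, with the orientation factor): for `0 < u < 1` and every letter `a`,
`(σ(u) - pole a)⁻¹ · 2/(1+u)² = -Σ_{(c, b) ∈ sigmaLetter a} c · (u - pole b)⁻¹`.
[cite: Zhao2008, §4] -/
theorem sigma_letter (a : Fin 5) {u : ℝ} (hu0 : 0 < u) (hu1 : u < 1) :
    levelFourFactor a ((1 - u) / (1 + u)) * ((2 / (1 + u) ^ 2 : ℝ) : ℂ) =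
      -(((LevelFour.sigmaLetter a).map fun cb : ℤ × Fin 5 =>
          ((cb.1 : ℝ) : ℂ) * levelFourFactor cb.2 u).sum) := by
  have hv : (1 : ℂ) + u ≠ 0 := by
    have h : (0 : ℝ) < 1 + u := by linarith
    exact_mod_cast h.ne'
  have hu_ne : (u : ℂ) ≠ 0 := by exact_mod_cast hu0.ne'
  have hu1_ne : (u : ℂ) - 1 ≠ 0 := by
    have h : u - 1 ≠ 0 := (sub_neg.mpr hu1).ne
    exact_mod_cast h
  have huI : (u : ℂ) - I ≠ 0 := fun h => by simpa using congrArg Complex.im h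
  have huI' : (u : ℂ) - -I ≠ 0 := fun h => by simpa using congrArg Complex.im h
  have hI1 : (1 : ℂ) + I ≠ 0 := fun h => by simpa using congrArg Complex.re h
  have hI2 : (1 : ℂ) + -I ≠ 0 := fun h => by simpa using congrArg Complex.re h
  rw [levelFourFactor_eq]
  push_cast
  fin_cases a <;> simp only [levelFourPole] <;> push_cast
  · rw [sigma_cayley (q := 0) (by norm_num) (by norm_num) hv (by simpa using hu_ne)]
    simp [LevelFour.sigmaLetter, levelFourFactor_eq, levelFourPole]
    ring
  · rw [sigma_cayley (q := -I) hI2 (by rw [eq_div_iff hI2]; linear_combination (-1 : ℂ) * I_mul_I)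
      hv huI']
    simp [LevelFour.sigmaLetter, levelFourFactor_eq, levelFourPole]
    ring
  · rw [sigma_cayley_neg_one hv]
    simp [LevelFour.sigmaLetter, levelFourFactor_eq, levelFourPole]
  · rw [sigma_cayley (q := I) hI1 (by rw [eq_div_iff hI1]; linear_combination (-1 : ℂ) * I_mul_I)
      hv huI]
    simp [LevelFour.sigmaLetter, levelFourFactor_eq, levelFourPole]
    ring
  · rw [sigma_cayley (q := 1) (by norm_num) (by norm_num) hv hu1_ne]
    simp [LevelFour.sigmaLetter, levelFourFactor_eq, levelFourPole]
    ring

/-- The letter lemma as a finite sum over the positions of the table. [cite: Zhao2008, §4] -/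
theorem sigma_letter_fin (a : Fin 5) {u : ℝ} (hu0 : 0 < u) (hu1 : u < 1) :
    levelFourFactor a ((1 - u) / (1 + u)) * ((2 / (1 + u) ^ 2 : ℝ) : ℂ) =
      -∑ k : Fin (LevelFour.sigmaLetter a).length,
        ((((LevelFour.sigmaLetter a).get k).1 : ℝ) : ℂ) *
          levelFourFactor ((LevelFour.sigmaLetter a).get k).2 u := by
  rw [sigma_letter a hu0 hu1, sigma_sum_map_eq]

/-! ## The pointwise identity on the simplex -/

/-- **The pulled-back word integrand.** For `x ∈ (0,1)³`:
`F_W(Φ x) · ∏ⱼ 2/(1+xⱼ)² = -Σ_{(c,V) ∈ expand σ W} c · F_{reverse V}(x)`, `Φ(x)ⱼ = σ(x_{2-j})`,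
written as a finite sum over the positions in the three letter tables (three letter lemmas
multiplied out; the sign is `(-1)³`). [cite: Zhao2008, §4] -/
theorem sigma_pointwiseC (m₀ m₁ m₂ : Fin 5) {x : Fin 3 → ℝ} (hx0 : ∀ i, 0 < x i)
    (hx1 : ∀ i, x i < 1) :
    levelFourFactor m₀ ((1 - x 2) / (1 + x 2)) * levelFourFactor m₁ ((1 - x 1) / (1 + x 1)) *
        levelFourFactor m₂ ((1 - x 0) / (1 + x 0)) * ((∏ j, 2 / (1 + x j) ^ 2 : ℝ) : ℂ) =
      -∑ p : Fin (LevelFour.sigmaLetter m₀).length × Fin (LevelFour.sigmaLetter m₁).length ×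
          Fin (LevelFour.sigmaLetter m₂).length,
        (((((LevelFour.sigmaLetter m₀).get p.1).1 * (((LevelFour.sigmaLetter m₁).get p.2.1).1 *
            (((LevelFour.sigmaLetter m₂).get p.2.2).1 * 1)) : ℤ) : ℝ) : ℂ) *
          (levelFourFactor ((LevelFour.sigmaLetter m₂).get p.2.2).2 (x 0) *
            levelFourFactor ((LevelFour.sigmaLetter m₁).get p.2.1).2 (x 1) *
            levelFourFactor ((LevelFour.sigmaLetter m₀).get p.1).2 (x 2)) := by
  rw [Fin.prod_univ_three, Complex.ofReal_mul, Complex.ofReal_mul]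
  have e : ∀ a b c j₀ j₁ j₂ : ℂ, a * b * c * (j₀ * j₁ * j₂) = a * j₂ * (b * j₁) * (c * j₀) := by
    intros; ring
  rw [e, sigma_letter_fin m₀ (hx0 2) (hx1 2), sigma_letter_fin m₁ (hx0 1) (hx1 1),
    sigma_letter_fin m₂ (hx0 0) (hx1 0), neg_mul_neg, mul_neg, neg_inj, sigma_prod_three_sums]
  refine Finset.sum_congr rfl fun p _ => ?_
  push_cast
  ring

/-! ## The pulled-back representation along the involution -/

/-- **The pull-back of a representation on `Δ_w` along Zhao's involution exists as a
representation**: domain `Δ_w`, integrand `t ↦ r'.integrand (Φ t) · ∏ⱼ 2/(1+tⱼ)²`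
(`ℚ`-semialgebraic by composition with the rational bijection `Φ` of `Δ_w` and multiplication by
the rational Jacobian; absolutely integrable by the change-of-variables formula, `Φ` being an
injective differentiable self-bijection of `Δ_w` with `|det Φ'| = ∏ⱼ 2/(1+tⱼ)²`).
[cite: KontsevichZagier2001, §1.2 rule (2)] -/
theorem sigma_pullback_exists {w : ℕ} (r' : IntegralRep w)
    (hr' : r'.domain = {t | (∀ i, 0 < t i) ∧ (∀ i, t i < 1) ∧ StrictAnti t}) :
    ∃ r : IntegralRep w, r.domain = {t | (∀ i, 0 < t i) ∧ (∀ i, t i < 1) ∧ StrictAnti t} ∧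
      r.integrand = fun t => r'.integrand (fun j => (1 - t (Fin.rev j)) / (1 + t (Fin.rev j))) *
        ∏ j, 2 / (1 + t j) ^ 2 := by
  set D : Set (Fin w → ℝ) := {t | (∀ i, 0 < t i) ∧ (∀ i, t i < 1) ∧ StrictAnti t} with hD
  set Φ : (Fin w → ℝ) → (Fin w → ℝ) := fun t j => (1 - t (Fin.rev j)) / (1 + t (Fin.rev j))
    with hΦ
  set J : (Fin w → ℝ) → ℝ := fun t => ∏ j, 2 / (1 + t j) ^ 2 with hJ
  have hDsa : Literature.ModelTheory.ExponentialFields.IsSemialgebraic ℚ D :=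
    hr' ▸ r'.isSemialgebraic_domain
  have hpos : ∀ t ∈ D, ∀ k, 1 + t k ≠ 0 := fun t ht k => one_add_ne_zero_of_mem_simplex ht k
  have hΦsa : IsSemialgebraicMapOn ℚ D Φ := isSemialgebraicMapOn_octMap hDsa hpos
  have hbij : BijOn Φ D D := bijOn_octMap
  -- the Jacobian is a semialgebraic function: `2^w / ∏ⱼ (1 + Xⱼ)²`
  have hJsa : IsSemialgebraicFunOn ℚ D J := by
    have hq : ∀ x ∈ D, MvPolynomial.aeval x
        (∏ j : Fin w, (1 + MvPolynomial.X j) ^ 2 : MvPolynomial (Fin w) ℚ) ≠ 0 := by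
      intro x hx
      rw [map_prod]
      exact Finset.prod_ne_zero_iff.mpr fun j _ => by
        simpa using pow_ne_zero 2 (hpos x hx j)
    refine (isSemialgebraicFunOn_aeval_div_aeval hDsa (MvPolynomial.C ((2 : ℚ) ^ w))
      (∏ j : Fin w, (1 + MvPolynomial.X j) ^ 2) hq).congr fun x _ => ?_
    rw [hJ]
    simp only [map_prod, map_pow, map_add, map_one, MvPolynomial.aeval_X, MvPolynomial.aeval_C,
      eq_ratCast, Rat.cast_ofNat]
    rw [Finset.prod_div_distrib, Finset.prod_const, Finset.card_univ, Fintype.card_fin]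
  -- the pulled-back integrand is semialgebraic (composition, product) ...
  have hg : IsSemialgebraicFunOn ℚ D (fun t => r'.integrand (Φ t) * J t) := by
    have hcomp : IsSemialgebraicFunOn ℚ D (r'.integrand ∘ Φ) :=
      IsSemialgebraicFunOn.comp_isSemialgebraicMapOn_holds (hr' ▸ r'.isSemialgebraicFunOn_integrand)
        hΦsa hbij.mapsTo
    exact (IsSemialgebraicFunOn.mul_holds hcomp hJsa).congr fun t _ => rfl
  -- ... and absolutely integrable (change of variables)
  have hDm : MeasurableSet D :=
    Literature.ModelTheory.ExponentialFields.IsSemialgebraic.measurableSet_holds hDsa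
  have hgi : IntegrableOn (fun t => r'.integrand (Φ t) * J t) D := by
    have h1 : IntegrableOn r'.integrand (Φ '' D) := by
      rw [hbij.image_eq, ← hr']; exact r'.integrableOn
    have h2 := (integrableOn_image_iff_integrableOn_abs_det_fderiv_smul volume hDm
      (fun t ht => (hasFDerivAt_octMap (hpos t ht)).hasFDerivWithinAt) hbij.injOn
      r'.integrand).mp h1
    refine h2.congr_fun (fun t _ => ?_) hDm
    show |(LinearMap.toContinuousLinearMap (Matrix.toLin'
      ((Matrix.diagonal fun k => -2 / (1 + t k) ^ 2).submatrix (Fin.revPerm : Fin w ≃ Fin w)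
        (Equiv.refl (Fin w))))).det| • r'.integrand (Φ t) = r'.integrand (Φ t) * J t
    rw [abs_det_octDeriv, smul_eq_mul, mul_comm]
  exact ⟨⟨D, fun t => r'.integrand (Φ t) * J t, hDsa, hg, hgi⟩, rfl, rfl⟩

/-! ## Integer scaling is integrand additivity -/

/-- `[σ, k f] − k • [σ, f] ∈ relations` for an integer `k` (rule (1b) iterated,
`KZ.IntegralRep.of_constMul_nat_sub_nsmul_mem_relations`, plus one sign flip for `k < 0`).
[cite: KontsevichZagier2001, §1.2 rule (1)] -/
theorem sigma_of_constMul_sub_zsmul {n : ℕ} (R : IntegralRep n) (k : ℤ) :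
    of (R.constMul (k : ℝ) (isAlgebraic_int k)) - k • of R ∈ relations := by
  rcases Int.eq_nat_or_neg k with ⟨m, rfl | rfl⟩
  · have h1 : of (R.constMul ((m : ℤ) : ℝ) (isAlgebraic_int (m : ℤ))) -
        of (R.constMul (m : ℝ) (isAlgebraic_nat m)) ∈ relations :=
      of_sub_of_mem_relations_of_eqOn rfl fun x _ => by simp
    have h2 := R.of_constMul_nat_sub_nsmul_mem_relations m
    convert relations.add_mem h1 h2 using 1
    rw [natCast_zsmul]; abel
  · have h1 : of (R.constMul (m : ℝ) (isAlgebraic_nat m)) +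
        of (R.constMul ((-(m : ℤ) : ℤ) : ℝ) (isAlgebraic_int (-(m : ℤ)))) ∈ relations :=
      of_add_of_mem_relations_of_eqOn_neg rfl fun x _ => by simp
    have h2 := R.of_constMul_nat_sub_nsmul_mem_relations m
    convert relations.sub_mem h1 h2 using 1
    rw [neg_zsmul, natCast_zsmul]; abel

/-! ## The σ-engine -/

/-- **The σ-engine for an `ℝ`-linear part `π` of the complex word integrand** (`π = re` or
`im`).  Given representations `ρ a b c` on `Δ₃` of `π ∘ (word integrand of (a, b, c))` for the
convergent three-letter words and any class function `Z` with `Z [a, b, c] = [ρ a b c]` on them,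
for every convergent `W = (m₀, m₁, m₂)` the element `Z W + Σ_{(c,V) ∈ expand σ W} c • Z (reverse V)`
is a KZ relation: `[r] − [ρ W]` is one change of variables along `Φ` (`r` the pull-back,
`OctahedralInvolutionMove_of`), and `[r] + Σ c • [ρ (reverse V)]` is iterated integrand additivity
by the pointwise identity `sigma_pointwiseC` and the `ℝ`-linearity of `π`. [cite: Zhao2008, §4] -/
theorem sigma_core (π : ℂ →ₗ[ℝ] ℝ)
    (ρ : (a b c : Fin 5) → LevelFour.IsConvergent [a, b, c] → IntegralRep 3)
    (hρd : ∀ a b c h, (ρ a b c h).domain = {t | (∀ i, 0 < t i) ∧ (∀ i, t i < 1) ∧ StrictAnti t})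
    (hρi : ∀ a b c h t, (ρ a b c h).integrand t =
      π (levelFourFactor a (t 0) * levelFourFactor b (t 1) * levelFourFactor c (t 2)))
    (Z : List (Fin 5) → FormalRep) (hZ : ∀ a b c h, Z [a, b, c] = of (ρ a b c h))
    (m₀ m₁ m₂ : Fin 5) (h₀ : m₀ ≠ 0) (h₂ : m₂ ≠ 4) :
    Z [m₀, m₁, m₂] + ((LevelFour.expand LevelFour.sigmaLetter [m₀, m₁, m₂]).map
        fun cV => cV.1 • Z cV.2.reverse).sum ∈ relations := by
  -- the data attached to a position `p` in the three letter tables: coefficient and reversed word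
  obtain ⟨c, hc⟩ : ∃ c : _ → ℤ, ∀ p : Fin (LevelFour.sigmaLetter m₀).length ×
      Fin (LevelFour.sigmaLetter m₁).length × Fin (LevelFour.sigmaLetter m₂).length,
      c p = ((LevelFour.sigmaLetter m₀).get p.1).1 * (((LevelFour.sigmaLetter m₁).get p.2.1).1 *
        (((LevelFour.sigmaLetter m₂).get p.2.2).1 * 1)) := ⟨_, fun _ => rfl⟩
  obtain ⟨b, hb⟩ : ∃ b : _ → Fin 5 × Fin 5 × Fin 5, ∀ p : Fin (LevelFour.sigmaLetter m₀).length ×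
      Fin (LevelFour.sigmaLetter m₁).length × Fin (LevelFour.sigmaLetter m₂).length,
      b p = (((LevelFour.sigmaLetter m₂).get p.2.2).2, ((LevelFour.sigmaLetter m₁).get p.2.1).2,
        ((LevelFour.sigmaLetter m₀).get p.1).2) := ⟨_, fun _ => rfl⟩
  -- every reversed word of the expansion is convergent
  have hconv : ∀ p, LevelFour.IsConvergent [(b p).1, (b p).2.1, (b p).2.2] := fun p =>
    sigma_isConvergent_triple
      (by rw [hb]; exact sigma_table_ne_zero m₂ h₂ _ (List.get_mem _ _))
      (by rw [hb]; exact sigma_table_ne_four m₀ h₀ _ (List.get_mem _ _))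
  have hW : LevelFour.IsConvergent [m₀, m₁, m₂] := sigma_isConvergent_triple h₀ h₂
  -- the pulled-back representation and the one change of variables
  obtain ⟨r, hrd, hri⟩ := sigma_pullback_exists (ρ m₀ m₁ m₂ hW) (hρd _ _ _ _)
  have hmove : of r - of (ρ m₀ m₁ m₂ hW) ∈ relations :=
    changeOfVariablesRel_subset_relations
      (OctahedralInvolutionMove_of 3 r (ρ m₀ m₁ m₂ hW) hrd (hρd _ _ _ _) fun t _ => by rw [hri])
  -- integrand additivity: `[r] = Σ_p [Δ₃, (-c_p) · ρ_p.integrand]`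
  obtain ⟨R, hR⟩ : ∃ R : _ → IntegralRep 3, ∀ p, R p =
      (ρ (b p).1 (b p).2.1 (b p).2.2 (hconv p)).constMul ((-c p : ℤ) : ℝ)
        (isAlgebraic_int (-c p)) := ⟨_, fun _ => rfl⟩
  have hr : Fin.rev (0 : Fin 3) = 2 ∧ Fin.rev (1 : Fin 3) = 1 ∧ Fin.rev (2 : Fin 3) = 0 := by decide
  have hlin : ∀ (z : ℂ) (a : ℝ), π (z * (a : ℂ)) = π z * a := fun z a => by
    rw [mul_comm z, ← Complex.real_smul, map_smul, smul_eq_mul, mul_comm]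
  have hlin' : ∀ (a : ℝ) (z : ℂ), π ((a : ℂ) * z) = a * π z := fun a z => by
    rw [← Complex.real_smul, map_smul, smul_eq_mul]
  have hadd : of r - ∑ p, of (R p) ∈ relations := by
    refine of_sub_sum_integrand_mem_relations Finset.univ R r
      (fun p _ => by rw [hR, IntegralRep.domain_constMul, hρd, hrd]) fun x hx => ?_
    rw [hrd] at hx
    obtain ⟨hx0, hx1, -⟩ := hx
    have hpw := sigma_pointwiseC m₀ m₁ m₂ hx0 hx1
    rw [hri]
    simp only [hR, IntegralRep.integrand_constMul, hρi, hr.1, hr.2.1, hr.2.2, hc, hb]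
    rw [← hlin, hpw, map_neg, map_sum]
    simp only [hlin', Int.cast_neg, neg_mul, Finset.sum_neg_distrib]
  -- integer scaling: `[Δ₃, (-c_p) · ρ_p.integrand] + c_p • [ρ_p] ∈ relations`
  have hscale : ∑ p, (of (R p) + c p • of (ρ (b p).1 (b p).2.1 (b p).2.2 (hconv p))) ∈
      relations := by
    refine sum_mem fun p _ => ?_
    rw [hR]
    have h := sigma_of_constMul_sub_zsmul (ρ (b p).1 (b p).2.1 (b p).2.2 (hconv p)) (-c p)
    rwa [neg_zsmul, sub_neg_eq_add] at h
  -- assemble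
  have key : Z [m₀, m₁, m₂] + ∑ p, c p • Z [(b p).1, (b p).2.1, (b p).2.2] ∈ relations := by
    have hsum : ∑ p, c p • Z [(b p).1, (b p).2.1, (b p).2.2] =
        ∑ p, c p • of (ρ (b p).1 (b p).2.1 (b p).2.2 (hconv p)) :=
      Finset.sum_congr rfl fun p _ => by rw [hZ _ _ _ (hconv p)]
    rw [hZ _ _ _ hW, hsum]
    have e : of (ρ m₀ m₁ m₂ hW) + ∑ p, c p • of (ρ (b p).1 (b p).2.1 (b p).2.2 (hconv p)) =
        (of r - ∑ p, of (R p)) - (of r - of (ρ m₀ m₁ m₂ hW)) +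
          ∑ p, (of (R p) + c p • of (ρ (b p).1 (b p).2.1 (b p).2.2 (hconv p))) := by
      rw [Finset.sum_add_distrib]; abel
    rw [e]
    exact relations.add_mem (relations.sub_mem hadd hmove) hscale
  rw [sigma_expand_triple]
  simp only [List.reverse_cons, List.reverse_nil, List.nil_append, List.cons_append]
  simpa only [hc, hb] using key

/-- **Stub `stub_sigma`** (engine σ, weight 3): for a convergent word `W = (m₀, m₁, m₂)` the
element `[W] + Σ_{(c,V) ∈ expand σ W} c·[reverse V]` (real parts, and imaginary parts) is a KZ
relation: ONE change of variables `t ↦ (σ t₂, σ t₁, σ t₀)` on `Δ₃` (`OctahedralInvolutionMove_of`,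
|J| = ∏ 2/(1+tⱼ)²) followed by the letterwise partial fractions `σ^*ω_a = ω_{σa} − ω_{−1}`,
`σ^*ω_{−1} = −ω_{−1}` and trilinear expansion (rule (1b)); every word in the expansion is
convergent. [cite: Zhao2008, §4] -/
theorem stub_sigma (Zr Zi : List (Fin 5) → FormalRep)
    (hZr : ∀ (W : List (Fin 5)) (h : LevelFour.IsConvergent W),
      Zr W = of (levelFourRepRe W (integrableOn_levelFourIntegrandC h)))
    (hZi : ∀ (W : List (Fin 5)) (h : LevelFour.IsConvergent W),
      Zi W = of (levelFourRepIm W (integrableOn_levelFourIntegrandC h)))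
    (m₀ m₁ m₂ : Fin 5) (h₀ : m₀ ≠ 0) (h₂ : m₂ ≠ 4) :
    Zr [m₀, m₁, m₂] + ((LevelFour.expand LevelFour.sigmaLetter [m₀, m₁, m₂]).map
        fun cV => cV.1 • Zr cV.2.reverse).sum ∈ relations ∧
    Zi [m₀, m₁, m₂] + ((LevelFour.expand LevelFour.sigmaLetter [m₀, m₁, m₂]).map
        fun cV => cV.1 • Zi cV.2.reverse).sum ∈ relations := by
  constructor
  · exact sigma_core Complex.reLm
      (fun a b c h => levelFourRepRe [a, b, c] (integrableOn_levelFourIntegrandC h))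
      (fun _ _ _ _ => rfl)
      (fun a b c h t => by
        show (levelFourIntegrandC [a, b, c] t).re = _
        rw [sigma_integrandC_triple]
        rfl)
      Zr (fun a b c h => hZr [a, b, c] h) m₀ m₁ m₂ h₀ h₂
  · exact sigma_core Complex.imLm
      (fun a b c h => levelFourRepIm [a, b, c] (integrableOn_levelFourIntegrandC h))
      (fun _ _ _ _ => rfl)
      (fun a b c h t => by
        show (levelFourIntegrandC [a, b, c] t).im = _
        rw [sigma_integrandC_triple]
        rfl)
      Zi (fun a b c h => hZi [a, b, c] h) m₀ m₁ m₂ h₀ h₂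

end Summit.KontsevichZagierPeriods.OctahedralSymmetry.ZhaoRelationInKZ

end
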